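import Summits.BirchSwinnertonDyer.BirchSwinnertonDyer.Theorems.ResidualThetaTransportAtTwoThetaLayerLambdaCongruenceAtTwoManinSystemFactor
import Summits.BirchSwinnertonDyer.Rank1Residual.ManinAdditive.ShimuraFiveQuotientAtEleven
import Summits.BirchSwinnertonDyer.BirchSwinnertonDyer.Theorems.ResidualThetaTransportAtTwoThetaLayerLambdaCongruenceAtTwoDualChainAcyclic
import Summits.BirchSwinnertonDyer.Rank2.LevelFifteenEisensteinPeriod
import Literature.NumberTheory.EllipticCurves.ModularCurveEtaProductsProofs
import Literature.NumberTheory.EllipticCurves.ManinConstantGamma1ModularDegree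
import HarnessLib

/-!
# C2 `ManinOddAtFour` helper (es g45, T-es-101) — THE SHIMURA INDEX AT LEVEL `11` IS NOT PRIME TO `5`:
# `Λ₁(f) ≠ Λ(f)` for every non-zero `f ∈ S₂(Γ₀(11))`, FACT-FREE (no Literature hypothesis, no sorry)

HONEST FRAMING. Printed mathematics (Mazur 1977 §II.11: the Shimura subgroup of `J₀(11)` has order `5`;
Stevens 1985 §1; Merel 1996), new formal proof. Beyond-print theorem: NO. Nothing about any elliptic curve is
asserted; the Manin conjecture `c = 1`, C2, C3 and BSD stay OPEN.

WHAT. Let `χ : (ℤ/11)ˣ → ℤ/5` be the discrete logarithm to base `2` reduced mod `5` (`shimuraChar`; the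
character of order `5` cutting out the Shimura covering `X₁(11) → X_χ → X₀(11)`). The **Shimura cusp
function** `g ↦ χ(g₁₀)` (resp. `−χ(g₀₀)` on the fibre `11 ∣ g₁₀`) on `SL₂(ℤ)` (`cuspChar`) is right-`T`- and
sign-invariant and LEFT `Γ₀(11)`-EQUIVARIANT with cocycle `χ(d_δ)` (`cuspChar_gamma0_mul`); its coboundary
`MS(h) = cuspChar h − cuspChar (hS)` is therefore a left-invariant Manin system on `SL₂(ℤ)/Γ₀(11)` satisfying the
two- and three-term relations, vanishing on `S`-fixed cosets (`2·MS = 0 ⇒ MS = 0` in `ℤ/5`) and on `TS`-fixed cosets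
(`3·MS = 0`). The landed factorisation theorem `exists_addMonoidHom_periodHomology_of_maninSystem` (route
ResidualThetaTransportAtTwo, fact-free: the genus formula for `Γ₀(N)` is a theorem in the tree) turns it into an
additive map `φ : H₁(X₀(11), ℤ) = periodHomology 11 →+ ℤ/5` with `φ({∞, k∞}) = χ(d_k)` for every `k ∈ Γ₀(11)`
(`exists_shimuraHom_eleven`) — the Shimura covering class. Since `dim S₂(Γ₀(11)) = 1`
(`finrank_cuspForm_two_eq_genusX0_eleven`, a theorem), evaluation at a non-zero `f` is injective on the dual, so
`φ` descends to `Λ(f) → ℤ/5`, kills `Λ₁(f)` and takes the value `χ(2) = 1 ≠ 0` on `{∞, γ∞}_f` for any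
`γ ∈ Γ₀(11)` with `d_γ ≡ 2 (mod 11)`: hence `{∞, γ∞}_f ∉ Λ₁(f)` (`cuspSymbol_not_mem_periodLatticeGamma1_eleven`)
and `Λ(f) ≠ Λ₁(f)` (`periodLattice_ne_periodLatticeGamma1_eleven`). §5 joins this to the landed es-g45
node `…ManinAdditive.ShimuraFiveQuotientAtEleven` (p781626): `ShimuraFiveNonVacuousAtEleven` (E-es-244) and
`ShimuraFiveNonVacuousAtElevenData` (E-es-245) HOLD fact-free, E-es-246 holds on the newform of `11a`, and the
hypothesis set of `squarefreeShimuraFive_maninConstant_holds` (T-es-98, p780436) — a lattice-optimal globally-minimal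
datum at squarefree level with `5 ∣ [Λ : Λ₁]` — is INHABITED given modularity (`exists_isNewformOf`) alone.

References: [Mazur1977] §II.11; [Stevens1985] §1; [Merel1996]; [Manin1972] Thm. 1.6, Thm. 1.9;
[CremonaAlgorithms1997] §2.1–2.2.
-/

set_option autoImplicit false

noncomputable section

-- justification: the `Summit.BirchSwinnertonDyer.BirchSwinnertonDyer.…` path repeats a component (route-file convention)
set_option linter.dupNamespace false

open scoped Classical MatrixGroups

open CongruenceSubgroup Matrix.SpecialLinearGroup ModularGroup
open Literature.NumberTheory.EllipticCurves.ModularForms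
open Summit.BirchSwinnertonDyer.BirchSwinnertonDyer.Theorems.ThetaLayerLambdaCongruenceAtTwo
open Summit.BirchSwinnertonDyer.Rank1Residual.ManinAdditive.EsG45 (gammaTwo gammaTwo_apply_one_one_zmod)

namespace Summit.BirchSwinnertonDyer.BirchSwinnertonDyer.Theorems.ManinLocalTwoThree.ShimuraFive

/-! ## §1. The Shimura character `χ = log₂ mod 5` on `ℤ/11` -/

/-- `χ(2ᵏ mod 11) = k mod 5` on units, `χ(0) = 0`: the order-`5` character of `(ℤ/11)ˣ`. [folklore] -/
def shimuraChar (x : ZMod 11) : ZMod 5 :=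
  match x.val with
  | 2 => 1 | 3 => 3 | 4 => 2 | 5 => 4 | 6 => 4 | 7 => 2 | 8 => 3 | 9 => 1 | _ => 0

/-- `χ` is a homomorphism on units. [folklore] -/
theorem shimuraChar_mul (x y : ZMod 11) (hx : x ≠ 0) (hy : y ≠ 0) :
    shimuraChar (x * y) = shimuraChar x + shimuraChar y := by
  revert x y; decide

/-- `χ(−x) = χ(x)` (`χ(−1) = 0`). [folklore] -/
theorem shimuraChar_neg (x : ZMod 11) : shimuraChar (-x) = shimuraChar x := by
  revert x; decide

/-- `χ(1) = 0`. [folklore] -/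
@[simp] theorem shimuraChar_one : shimuraChar 1 = 0 := by decide

/-- `χ(2) = 1 ≠ 0`. [folklore] -/
theorem shimuraChar_two : shimuraChar 2 = 1 := by decide

/-- In `ℤ/11`, `a·d = 1 ⇒ a ≠ 0 ∧ d ≠ 0`. [folklore] -/
theorem ne_zero_of_mul_eq_one_zmod11 (a d : ZMod 11) (h : a * d = 1) : a ≠ 0 ∧ d ≠ 0 := by
  revert a d; decide

/-- In `ℤ/11`, a product of non-zero elements is non-zero. [folklore] -/
theorem mul_ne_zero_zmod11 (x y : ZMod 11) (hx : x ≠ 0) (hy : y ≠ 0) : x * y ≠ 0 := by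
  revert x y; decide

/-! ## §2. The Shimura cusp function on `SL₂(ℤ)` and its Manin system -/

/-- The cusp function on first columns `(p, q)` mod `11`: `χ(q)` off the fibre `q = 0`, `−χ(p)` on it. [folklore] -/
def colChar (p q : ZMod 11) : ZMod 5 := if q = 0 then -shimuraChar p else shimuraChar q

/-- `colChar` is even. [folklore] -/
theorem colChar_neg (p q : ZMod 11) : colChar (-p) (-q) = colChar p q := by
  simp only [colChar, neg_eq_zero, shimuraChar_neg]

/-- **Left `Γ₀(11)`-equivariance on first columns**: for `δ = (a b; c d)` with `c ≡ 0`, `ad ≡ 1`, and a primitive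
column `(p, q)`, `colChar(δ·(p,q)) = colChar(p,q) + χ(d)`. [folklore] -/
theorem colChar_gamma0 (a b d p q : ZMod 11) (had : a * d = 1) (hpq : p ≠ 0 ∨ q ≠ 0) :
    colChar (a * p + b * q) (d * q) = colChar p q + shimuraChar d := by
  obtain ⟨ha, hd⟩ := ne_zero_of_mul_eq_one_zmod11 a d had
  have hadχ : shimuraChar a + shimuraChar d = 0 := by rw [← shimuraChar_mul a d ha hd, had, shimuraChar_one]
  by_cases hq : q = 0
  · subst hq
    have hp : p ≠ 0 := hpq.resolve_right (fun h ↦ h rfl)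
    simp only [colChar, mul_zero, add_zero, if_true, shimuraChar_mul a p ha hp]
    linear_combination (-1 : ZMod 5) * hadχ
  · have hdq : d * q ≠ 0 := mul_ne_zero_zmod11 d q hd hq
    simp only [colChar, hq, hdq, if_false, shimuraChar_mul d q hd hq, add_comm]

/-- **The Shimura cusp function** `g ↦ colChar(g₀₀, g₁₀)` on `SL₂(ℤ)` (a function of the cusp `g∞` of `X₁(11)`
through the character `χ`). [folklore] -/
def cuspChar (g : SL(2, ℤ)) : ZMod 5 := colChar (((g 0 0 : ℤ) : ZMod 11)) (((g 1 0 : ℤ) : ZMod 11))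

/-- `cuspChar` only sees the first column. [folklore] -/
theorem cuspChar_congr {g h : SL(2, ℤ)} (h0 : g 0 0 = h 0 0) (h1 : g 1 0 = h 1 0) : cuspChar g = cuspChar h := by
  simp only [cuspChar, h0, h1]

/-- Right `T`-invariance. [folklore] -/
theorem cuspChar_mul_T (g : SL(2, ℤ)) : cuspChar (g * T) = cuspChar g := by
  apply cuspChar_congr <;> simp [_root_.Summit.BirchSwinnertonDyer.Rank2.LevelFifteen.sl_mul_apply', coe_T]

/-- Sign invariance. [folklore] -/
theorem cuspChar_neg (g : SL(2, ℤ)) : cuspChar (-g) = cuspChar g := by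
  have e0 : (-g) 0 0 = -g 0 0 := by simp
  have e1 : (-g) 1 0 = -g 1 0 := by simp
  simp only [cuspChar, e0, e1, Int.cast_neg, colChar_neg]

/-- The first column of `g ∈ SL₂(ℤ)` is primitive mod `11`. [folklore] -/
theorem col_ne_zero (g : SL(2, ℤ)) : ((g 0 0 : ℤ) : ZMod 11) ≠ 0 ∨ ((g 1 0 : ℤ) : ZMod 11) ≠ 0 := by
  by_contra h
  rw [not_or, not_not, not_not] at h
  have hdet : (g 0 0 : ℤ) * g 1 1 - g 0 1 * g 1 0 = 1 := by
    have := Matrix.SpecialLinearGroup.det_coe g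
    rwa [Matrix.det_fin_two] at this
  have := congrArg (Int.cast : ℤ → ZMod 11) hdet
  push_cast at this
  rw [h.1, h.2, mul_zero, zero_mul, sub_zero] at this
  revert this; decide

/-- **Left `Γ₀(11)`-equivariance**: `cuspChar(δg) = cuspChar(g) + χ(d_δ)`. [folklore] -/
theorem cuspChar_gamma0_mul (δ : Gamma0 11) (g : SL(2, ℤ)) :
    cuspChar ((δ : SL(2, ℤ)) * g) = cuspChar g + shimuraChar ((((δ : SL(2, ℤ)) 1 1 : ℤ) : ZMod 11)) := by
  have hc : ((((δ : SL(2, ℤ)) 1 0 : ℤ) : ZMod 11)) = 0 := by exact_mod_cast Gamma0_mem.mp δ.2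
  have hdet : ((δ : SL(2, ℤ)) 0 0 : ℤ) * (δ : SL(2, ℤ)) 1 1 - (δ : SL(2, ℤ)) 0 1 * (δ : SL(2, ℤ)) 1 0 = 1 := by
    have := Matrix.SpecialLinearGroup.det_coe (δ : SL(2, ℤ))
    rwa [Matrix.det_fin_two] at this
  have had : ((((δ : SL(2, ℤ)) 0 0 : ℤ) : ZMod 11)) * ((((δ : SL(2, ℤ)) 1 1 : ℤ) : ZMod 11)) = 1 := by
    have := congrArg (Int.cast : ℤ → ZMod 11) hdet
    push_cast at this
    rw [hc, mul_zero, sub_zero] at this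
    exact this
  have e0 : (((((δ : SL(2, ℤ)) * g) 0 0 : ℤ) : ZMod 11)) =
      ((((δ : SL(2, ℤ)) 0 0 : ℤ) : ZMod 11)) * (((g 0 0 : ℤ) : ZMod 11)) +
        ((((δ : SL(2, ℤ)) 0 1 : ℤ) : ZMod 11)) * (((g 1 0 : ℤ) : ZMod 11)) := by
    rw [_root_.Summit.BirchSwinnertonDyer.Rank2.LevelFifteen.sl_mul_apply']; push_cast; ring
  have e1 : (((((δ : SL(2, ℤ)) * g) 1 0 : ℤ) : ZMod 11)) =
      ((((δ : SL(2, ℤ)) 1 1 : ℤ) : ZMod 11)) * (((g 1 0 : ℤ) : ZMod 11)) := by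
    rw [_root_.Summit.BirchSwinnertonDyer.Rank2.LevelFifteen.sl_mul_apply']; push_cast; rw [hc, zero_mul, zero_add]
  rw [cuspChar, e0, e1, cuspChar]
  exact colChar_gamma0 _ _ _ _ _ had (col_ne_zero g)

/-- `cuspChar 1 = 0`. [folklore] -/
@[simp] theorem cuspChar_one : cuspChar 1 = 0 := by
  simp [cuspChar, colChar]

/-- On `Γ₀(11)`: `cuspChar k = χ(d_k)`. [folklore] -/
theorem cuspChar_gamma0 (k : Gamma0 11) : cuspChar (k : SL(2, ℤ)) = shimuraChar ((((k : SL(2, ℤ)) 1 1 : ℤ) : ZMod 11)) := by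
  have := cuspChar_gamma0_mul k 1
  rwa [mul_one, cuspChar_one, zero_add] at this

/-- **The Shimura Manin system** `MS(h) = cuspChar h − cuspChar (hS)` on `SL₂(ℤ)`. [folklore] -/
def maninShimura (h : SL(2, ℤ)) : ZMod 5 := cuspChar h - cuspChar (h * S)

/-- Left `Γ₀(11)`-invariance (the cocycle cancels). [folklore] -/
theorem maninShimura_inv (δ : Gamma0 11) (h : SL(2, ℤ)) : maninShimura ((δ : SL(2, ℤ)) * h) = maninShimura h := by
  simp only [maninShimura, mul_assoc, cuspChar_gamma0_mul]
  ring

/-- Sign invariance. [folklore] -/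
theorem maninShimura_neg (h : SL(2, ℤ)) : maninShimura (-h) = maninShimura h := by
  simp only [maninShimura, neg_mul, cuspChar_neg]

/-- Two-term relation `MS(hS) = −MS(h)`. [folklore] -/
theorem maninShimura_S (h : SL(2, ℤ)) : maninShimura (h * S) = -maninShimura h := by
  simp only [maninShimura, mul_assoc, S_mul_S_eq_neg_one, mul_neg, mul_one, cuspChar_neg]
  ring

/-- Three-term relation `MS(h) + MS(hτ) + MS(hτ²) = 0`, `τ = S T⁻¹` (the cusp triangle `h∞, h0, h1`). [folklore] -/
theorem maninShimura_three_term (h : SL(2, ℤ)) :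
    maninShimura h + maninShimura (h * (S * T⁻¹)) + maninShimura (h * (S * T⁻¹) * (S * T⁻¹)) = 0 := by
  rw [_root_.Summit.BirchSwinnertonDyer.BirchSwinnertonDyer.Theorems.ThetaLayerLambdaCongruenceAtTwo.S_mul_T_inv_eq]
  set τ : SL(2, ℤ) := ⟨!![0, -1; 1, -1], by norm_num [Matrix.det_fin_two_of]⟩ with hτ
  have t00 : τ 0 0 = 0 := rfl
  have t10 : τ 1 0 = 1 := rfl
  have t01 : τ 0 1 = -1 := rfl
  have t11 : τ 1 1 = -1 := rfl
  have s00 : (S : SL(2, ℤ)) 0 0 = 0 := rfl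
  have s10 : (S : SL(2, ℤ)) 1 0 = 1 := rfl
  have e1 : cuspChar (h * τ) = cuspChar (h * S) := by
    apply cuspChar_congr <;> simp only [_root_.Summit.BirchSwinnertonDyer.Rank2.LevelFifteen.sl_mul_apply', t00, t10, s00, s10]
  have e2 : cuspChar (h * τ * τ) = cuspChar (h * τ * S) := by
    apply cuspChar_congr <;> simp only [_root_.Summit.BirchSwinnertonDyer.Rank2.LevelFifteen.sl_mul_apply', t00, t10, s00, s10]
  have e3 : cuspChar (h * τ * τ * S) = cuspChar h := by
    apply cuspChar_congr <;> simp only [_root_.Summit.BirchSwinnertonDyer.Rank2.LevelFifteen.sl_mul_apply', t00, t10, t01, t11, s00, s10] <;> ring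
  simp only [maninShimura, e1, e2, e3]
  ring

/-- Vanishing on `S`-fixed cosets: `δh = hS` ⇒ `MS(h) = −MS(h)` ⇒ `MS(h) = 0` in `ℤ/5`. [folklore] -/
theorem maninShimura_sigma_fixed (δ : Gamma0 11) (h : SL(2, ℤ)) (hfix : (δ : SL(2, ℤ)) * h = h * S) :
    maninShimura h = 0 := by
  have e : maninShimura h = -maninShimura h := by
    rw [← maninShimura_S, ← hfix, maninShimura_inv]
  have h2 : ∀ r : ZMod 5, r = -r → r = 0 := by decide
  exact h2 _ e

/-! ## §3. The Shimura covering class `φ : H₁(X₀(11), ℤ) → ℤ/5` -/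

/-- **The Shimura covering class.** There is an additive map `φ : periodHomology 11 →+ ℤ/5` on
`H₁(X₀(11), ℤ) ⊂ S₂(Γ₀(11))^∨` with `φ({∞, k∞}) = χ(d_k)` for every `k ∈ Γ₀(11)` — the class of the cyclic
degree-`5` Shimura covering `X_χ → X₀(11)`; it kills the image of `Γ₁(11)`. (Manin's theorem 1.9 via the landed
`exists_addMonoidHom_periodHomology_of_maninSystem`, applied to the Shimura Manin system.) [cite: Manin1972, Thm. 1.9] -/
theorem exists_shimuraHom_eleven : ∃ φ : periodHomology 11 →+ ZMod 5, ∀ k : Gamma0 11,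
    φ ⟨periodFunctional 11 k, periodFunctional_mem_periodHomology 11 k⟩ =
      shimuraChar ((((k : SL(2, ℤ)) 1 1 : ℤ) : ZMod 11)) := by
  have h3 : ∀ r : ZMod 5, r + r + r = 0 → r = 0 := by decide
  have hinv : ∀ (δ : Gamma0 11) (h : SL(2, ℤ)), maninShimura ((δ : SL(2, ℤ)) * h) = maninShimura h :=
    maninShimura_inv
  have hτ0 : ∀ (δ : Gamma0 11) (h : SL(2, ℤ)), (δ : SL(2, ℤ)) * h = h * (S * T⁻¹) → maninShimura h = 0 :=
    fun δ h hfix ↦ apply_eq_zero_of_tau_fixed maninShimura hinv maninShimura_three_term h3 δ h hfix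
  set M : Gamma0Coset 11 → ZMod 5 := fun q ↦ maninShimura (q.out)⁻¹ with hMdef
  have hM1 : ∀ q, M (S • q) = -M q := fun q ↦ cosetSystem_S maninShimura hinv maninShimura_neg maninShimura_S q
  have hM2 : ∀ q, M q + M ((T * S) • q) + M ((T * S) • (T * S) • q) = 0 := fun q ↦
    cosetSystem_TS maninShimura hinv maninShimura_neg maninShimura_three_term q
  have hM3 : ∀ q, S • q = q → M q = 0 := fun q hq ↦
    cosetSystem_S_fixed maninShimura hinv maninShimura_sigma_fixed q hq
  have hM4 : ∀ q, (T * S) • q = q → M q = 0 := fun q hq ↦ cosetSystem_TS_fixed maninShimura hinv hτ0 q hq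
  obtain ⟨φ, hφ⟩ := exists_addMonoidHom_periodHomology_of_maninSystem M hM1 hM2 hM3 hM4 h3
  refine ⟨φ, fun k ↦ ?_⟩
  obtain ⟨L, hL⟩ := exists_maninChain.{0} (k : SL(2, ℤ))
  rw [hφ k L hL]
  have e : (L.map fun g ↦ M ((g⁻¹ : SL(2, ℤ)) : Gamma0Coset 11)) = L.map fun g ↦ cuspChar g - cuspChar (g * S) := by
    refine List.map_congr_left fun g _ ↦ ?_
    show maninShimura (((g⁻¹ : SL(2, ℤ)) : Gamma0Coset 11).out)⁻¹ = _
    rw [apply_out_inv_mk maninShimura hinv, inv_inv]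
    rfl
  rw [e, hL cuspChar cuspChar_mul_T cuspChar_neg, cuspChar_one, sub_zero, cuspChar_gamma0]

/-! ## §4. `Λ₁(f) ≠ Λ(f)` at level `11` -/

/-- **The period `{∞, γ∞}_f`, `d_γ ∉ ⟨±1⟩ · ker χ`, is not a `Γ₁(11)`-period.** For `f ∈ S₂(Γ₀(11))`, `f ≠ 0`,
and `γ ∈ Γ₀(11)` with `χ(d_γ) ≠ 0`: `{∞, γ∞}_f ∉ Λ₁(f)`. (The Shimura class `φ` kills `Λ₁`; evaluation at `f`
is injective on `S₂(Γ₀(11))^∨` since `dim S₂(Γ₀(11)) = 1`.) [cite: Mazur1977, §II.11] -/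
theorem cuspSymbol_not_mem_periodLatticeGamma1_eleven (f : CuspForm (Gamma0 11) 2) (hf : f ≠ 0) (γ : Gamma0 11)
    (hγ : shimuraChar ((((γ : SL(2, ℤ)) 1 1 : ℤ) : ZMod 11)) ≠ 0) :
    cuspSymbol f γ ∉ periodLatticeGamma1 f := by
  obtain ⟨φ, hφ⟩ := exists_shimuraHom_eleven
  have hspan : ∀ w : CuspForm (Gamma0 11) 2, ∃ c : ℂ, c • f = w :=
    (finrank_eq_one_iff_of_nonzero' f hf).mp finrank_cuspForm_two_eq_genusX0_eleven.2.1
  have hinj : ∀ x y : Module.Dual ℂ (CuspForm (Gamma0 11) 2), x f = y f → x = y := fun x y hxy ↦ by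
    refine LinearMap.ext fun w ↦ ?_
    obtain ⟨c, rfl⟩ := hspan w
    rw [map_smul, map_smul, hxy]
  intro hmem
  have key : ∀ z ∈ periodLatticeGamma1 f, ∃ x : periodHomology 11,
      (x : Module.Dual ℂ (CuspForm (Gamma0 11) 2)) f = z ∧ φ x = 0 := by
    intro z hz
    refine AddSubgroup.closure_induction (fun z hz ↦ ?_) ?_ (fun x y _ _ hx hy ↦ ?_) (fun x _ hx ↦ ?_) hz
    · obtain ⟨γ₁, rfl⟩ := hz
      refine ⟨⟨periodFunctional 11 ⟨(γ₁ : SL(2, ℤ)), Gamma1_in_Gamma0 11 γ₁.2⟩,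
        periodFunctional_mem_periodHomology 11 _⟩, rfl, ?_⟩
      rw [hφ]
      have h11 : (((((⟨(γ₁ : SL(2, ℤ)), Gamma1_in_Gamma0 11 γ₁.2⟩ : Gamma0 11) : SL(2, ℤ)) 1 1 : ℤ) : ZMod 11)) = 1 :=
        ((Gamma1_mem 11 _).mp γ₁.2).2.1
      rw [h11, shimuraChar_one]
    · exact ⟨0, by simp, map_zero φ⟩
    · obtain ⟨a, ha, ha0⟩ := hx
      obtain ⟨b, hb, hb0⟩ := hy
      exact ⟨a + b, by simp [ha, hb], by rw [map_add, ha0, hb0, add_zero]⟩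
    · obtain ⟨a, ha, ha0⟩ := hx
      exact ⟨-a, by simp [ha], by rw [map_neg, ha0, neg_zero]⟩
  obtain ⟨x, hx, hx0⟩ := key _ hmem
  have hxe : x = ⟨periodFunctional 11 γ, periodFunctional_mem_periodHomology 11 γ⟩ :=
    Subtype.ext (hinj _ _ (by rw [hx, periodFunctional_apply]))
  rw [hxe, hφ] at hx0
  exact hγ hx0

/-- **`{∞, γ₂∞}_f ∉ Λ₁(f)`** for every non-zero `f ∈ S₂(Γ₀(11))`, `γ₂ = (6 1; 11 2)` the node's `EsG45.gammaTwo`.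
[cite: Mazur1977, §II.11] -/
theorem cuspSymbol_gammaTwo_not_mem (f : CuspForm (Gamma0 11) 2) (hf : f ≠ 0) :
    cuspSymbol f gammaTwo ∉ periodLatticeGamma1 f :=
  cuspSymbol_not_mem_periodLatticeGamma1_eleven f hf gammaTwo (by
    rw [gammaTwo_apply_one_one_zmod, shimuraChar_two]; decide)

/-- **THE SHIMURA INDEX AT LEVEL `11` IS NOT `1`: `Λ(f) ≠ Λ₁(f)`** for every non-zero `f ∈ S₂(Γ₀(11))` — the
`N = 11` non-vacuity of the Shimura-index hypothesis (es E-es-244 `ShimuraFiveNonVacuousAtEleven`), fact-free.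
[cite: Mazur1977, §II.11] -/
theorem periodLattice_ne_periodLatticeGamma1_eleven (f : CuspForm (Gamma0 11) 2) (hf : f ≠ 0) :
    periodLattice f ≠ periodLatticeGamma1 f := fun h ↦
  cuspSymbol_gammaTwo_not_mem f hf (h ▸ cuspSymbol_mem_periodLattice f gammaTwo)

end Summit.BirchSwinnertonDyer.BirchSwinnertonDyer.Theorems.ManinLocalTwoThree.ShimuraFive

/-! ## §5. Edges to the es-g45 node `…ManinAdditive.ShimuraFiveQuotientAtEleven` (E-es-244 / E-es-245 / E-es-246) -/

open scoped MatrixGroups ModularForm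
open CongruenceSubgroup WeierstrassCurve Literature.NumberTheory.EllipticCurves
open Literature.NumberTheory.EllipticCurves.ModularForms
open Summit.BirchSwinnertonDyer.Rank1Residual.ManinAdditive.KatoCurve (ShimuraIndexPrimeTo)
open Summit.BirchSwinnertonDyer.Rank1Residual.ManinAdditive.EsG45

namespace Summit.BirchSwinnertonDyer.BirchSwinnertonDyer.Theorems.ManinLocalTwoThree.ShimuraFive

/-- **E-es-244 HOLDS (fact-free)**: `Λ(f) ≠ Λ₁(f)` for every non-zero `f ∈ S₂(Γ₀(11))`. [cite: Mazur1977, §II.11] -/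
theorem shimuraFiveNonVacuousAtEleven_holds : ShimuraFiveNonVacuousAtEleven :=
  fun f hf ↦ periodLattice_ne_periodLatticeGamma1_eleven f hf

/-- **E-es-245 HOLDS (fact-free)**: no `X₀(11)`-datum has Shimura index prime to `5`. [cite: LingOesterle1991, Thm. 1] -/
theorem shimuraFiveNonVacuousAtElevenData_holds : ShimuraFiveNonVacuousAtElevenData :=
  data_of_nonVacuous shimuraFiveNonVacuousAtEleven_holds

/-- At level `11` no non-zero form has Shimura index prime to `5`. [cite: Mazur1977, §II.11] -/
theorem not_shimuraIndexPrimeTo_five_eleven (f : CuspForm (Gamma0 11) 2) (hf : f ≠ 0) : ¬ ShimuraIndexPrimeTo 5 f :=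
  fun h ↦ periodLattice_ne_periodLatticeGamma1_eleven f hf ((shimuraIndexPrimeTo_five_iff_eq f).mp h)

/-- **The squarefree Shimura-`5` locus of T-es-98 is inhabited, given modularity alone** (`exists_isNewformOf`):
the class `11a` supplies a lattice-optimal globally-minimal `X₀(11)`-datum whose newform has `5 ∣ [Λ : Λ₁]`.
[cite: Stevens1989, §2] -/
theorem squarefreeShimuraFiveLocus_inhabited_of_isNewformOf (hnf : exists_isNewformOf) :
    ∃ (W₀ : WeierstrassCurve ℚ) (_ : W₀.IsElliptic) (_ : W₀.IsGloballyMinimal) (N : ℕ) (_ : NeZero N)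
      (D₀ : ModularParametrizationData W₀ N),
      (∀ z ∈ D₀.L.lattice, ∃ w ∈ periodLattice D₀.f, z = D₀.c * w) ∧ Squarefree N ∧ ¬ ShimuraIndexPrimeTo 5 D₀.f :=
  squarefreeShimuraFiveLocus_inhabited shimuraFiveNonVacuousAtEleven_holds hnf

/-- A newform of a curve is not the zero form (`a₁ = 1`). [folklore] -/
theorem ne_zero_of_isNewformOf {W : WeierstrassCurve ℚ} [W.IsElliptic] {N : ℕ} [NeZero N]
    {f : CuspForm (Gamma0 N) 2} (hf : IsNewformOf W f) : f ≠ 0 := by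
  intro h0
  have h1 : cuspCoeff f 1 = 1 := by
    rw [hf.2 1]; exact_mod_cast W.isMultiplicative_LFunction.map_one
  rw [h0, cuspCoeff_zero_form (one_mem_strictPeriods_coe_gamma0 N) 1] at h1
  exact zero_ne_one h1

/-- **E-es-246 on the newform of `11a`**: `5·{∞,0}_f ∉ Λ₁(f)` (`a₂(11a) = −2`, fact-free given the newform).
[cite: Mazur1977, §II.11] -/
theorem five_mul_modularSymbol_zero_not_mem_of_isNewformOf (f : CuspForm (Gamma0 11) 2)
    (hf : IsNewformOf X1Eleven.curve11A1 f) : (5 : ℂ) * modularSymbol f 0 ∉ periodLatticeGamma1 f :=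
  (lValue_not_mem_iff_ne_of_isNewformOf f hf).mpr
    (periodLattice_ne_periodLatticeGamma1_eleven f (ne_zero_of_isNewformOf hf))

end Summit.BirchSwinnertonDyer.BirchSwinnertonDyer.Theorems.ManinLocalTwoThree.ShimuraFive
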